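import Summits.AnomalousDissipation.AnomalousDissipation.Theorems.SolenoidalFractalHomogenisationLagrangianStepFrameGroupLaw
import Literature.Analysis.FluidPDE.LagrangianLatticeCarrierFrame
import HarnessLib

/-!
# K1L_D (stmt-AnomalousDissipation-27980), `stub_Z7_alphaBeta` α-provider, target (C0) of memo L15 completed: CONTINUITY of the inverse
# frame Jacobian `frameG` at ALL times, and the hypothesis-free solenoidality equivalence (L1) (helper; `--supports … --as helper`;
# lead-k1l-onelevel-p1 g5)

For a `LevelRegular` carrier the Jacobian entries `y ↦ frameJac E m t' s y a c = δ_ac + ∂_c (disp m t' s)_a (y)` are smooth at ALL times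
(`LevelRegular.flowDeriv_single_apply`, `isSmooth_disp`), so `frameJac` is a continuous matrix field; it is pointwise invertible
(`isUnit_frameJac`, p699864), hence `frameG = frameJac⁻¹` is continuous (`continuousAt_matrix_inv` + continuity of `Ring.inverse` at units).
Feeding (hU) := `isUnit_frameJac`, (hInv) := `flowDeriv_comp_inverse_apply`, (hGc) := `continuous_frameG_entry` into
`FrameConj.isWeaklyDivFree_distort_frameRead_iff` (p699106) gives the HYPOTHESIS-FREE form
**`isWeaklyDivFree_distort_frameRead_iff'`** — exactly the input `hL1` of `FrameConj.isDistortedPropagator_conjProp` (p698495), for every `σ : ℝ`.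
NOT a proof of the stub, of the crux, or of AD; rung F-D1.A0.
-/

set_option linter.dupNamespace false  -- the summit-side namespace `Summit.AnomalousDissipation.AnomalousDissipation.…` repeats a component by design (D-0017)

noncomputable section

namespace Summit.AnomalousDissipation.AnomalousDissipation.Theorems.SolenoidalFractalHomogenisation.LagrangianStep.FrameConj

open Literature.Analysis Literature.Analysis.FluidPDE Literature.Analysis.FunctionSpaces Literature.Analysis.FunctionSpaces.Torus
open MeasureTheory Set Filter Topology
open Literature.Analysis.FluidPDE.LatticeShear (LagrangianLatticeCarrier)

variable {k : ℕ}

/-! ## §1 Continuity of the frame Jacobian and of its inverse at all times -/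

/-- The Jacobian entries `y ↦ frameJac E m t' s y a c` are smooth at ALL times (the all-time form of FR1
`LevelRegular.isSmooth_flowDeriv_entry`). -/
theorem isSmooth_frameJac_entry (E : LagrangianLatticeCarrier k) (hR : E.LevelRegular) (m : ℕ) (t' s : ℝ) (a c : Fin 3) :
    IsSmooth (fun y => frameJac E m t' s y a c) := by
  simp_rw [frameJac, Matrix.of_apply, hR.flowDeriv_single_apply]
  exact (isSmooth_const _).add (((hR.isSmooth_disp m _ _).apply a).partialDeriv c)

/-- The frame Jacobian is a continuous matrix field at all times. -/
theorem continuous_frameJac (E : LagrangianLatticeCarrier k) (hR : E.LevelRegular) (m : ℕ) (t' s : ℝ) :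
    Continuous (fun y => frameJac E m t' s y) :=
  continuous_matrix fun a c => (isSmooth_frameJac_entry E hR m t' s a c).continuous

/-- **The inverse frame Jacobian `frameG` is continuous at all times** (inverse of a continuous, pointwise invertible matrix field). -/
theorem continuous_frameG (E : LagrangianLatticeCarrier k) (hR : E.LevelRegular) (m : ℕ) (t' s : ℝ) :
    Continuous (fun y => frameG E m t' s y) := by
  have hfun : (fun y => frameG E m t' s y) = Inv.inv ∘ fun y => frameJac E m t' s y := rfl
  rw [hfun]
  refine continuous_iff_continuousAt.2 fun y => ?_
  have hdet : IsUnit (frameJac E m t' s y).det := (Matrix.isUnit_iff_isUnit_det _).mp (isUnit_frameJac E hR m t' s y)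
  obtain ⟨u, hu⟩ := hdet
  have h1 : ContinuousAt Ring.inverse (frameJac E m t' s y).det := hu ▸ NormedRing.inverse_continuousAt u
  exact (continuousAt_matrix_inv _ h1).comp (continuous_frameJac E hR m t' s).continuousAt

/-- The entries of `frameG` are continuous at all times — the (hGc) input of `isWeaklyDivFree_distort_frameRead_iff`. -/
theorem continuous_frameG_entry (E : LagrangianLatticeCarrier k) (hR : E.LevelRegular) (m : ℕ) (t' s : ℝ) (c a : Fin 3) :
    Continuous fun y => frameG E m t' s y c a :=
  (continuous_frameG E hR m t' s).matrix_elem c a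

/-! ## §2 The hypothesis-free solenoidality equivalence (L1) -/

/-- **(L1), hypothesis-free**: for a `LevelRegular` carrier, at every base time `s` and every frame time `σ`, the frame reading
`frameRead E hR m s σ u` of an `L²` field `u`, distorted by the inverse Jacobian `frameG`, is weakly divergence-free iff `u` is.
This is the input `hL1` of `FrameConj.isDistortedPropagator_conjProp`, for all `σ : ℝ`. -/
theorem isWeaklyDivFree_distort_frameRead_iff' (E : LagrangianLatticeCarrier k) (hR : E.LevelRegular) (m : ℕ) (s σ : ℝ) (u : V2) :
    Torus.IsWeaklyDivFree (Torus.distort (frameG E m (s + σ / E.a (m + 1)) s) (⇑(frameRead E hR m s σ u) : VF)) ↔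
      Torus.IsWeaklyDivFree (⇑u : VF) :=
  isWeaklyDivFree_distort_frameRead_iff E hR m s σ (fun y => isUnit_frameJac E hR m _ _ y)
    (fun y w => flowDeriv_comp_inverse_apply E hR m _ _ y w) (fun c a => continuous_frameG_entry E hR m _ _ c a) u

end Summit.AnomalousDissipation.AnomalousDissipation.Theorems.SolenoidalFractalHomogenisation.LagrangianStep.FrameConj

end
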